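import Literature.Analysis.FluidPDE.SawtoothCascadeK2Classical

/-!
# K2 control: the material-dual (conormal) cocycle and the weighted budget algebra
(route `AnomalousDissipation/SawtoothPulseCascade`; helper for the crux K1loc = stmt-AnomalousDissipation-19491 / the re-targeted
K2 crux `K2GrowthCtgPointH`; §6 `section MaterialDual` + `section BudgetAlgebra` of planner ad-ideate-p4's crux sketch
`Cruxes/K1LocalisedCascade/K2ControlSketch.lean` v3.1 (F-p4g15-1), statements and proofs VERBATIM, landed as an importable
Theorems module at the K2 lane's request (prover ad-k1loc-p2 g9 23:54Z; tenure D26 «TAKES-p3 #2»); docstrings added where missing)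

* MATERIAL DUALITY: `rot` = the quarter turn `R`; `transpose_mul_rot_conj : Mᵀ(RMRᵀ) = det M • 1`; the pulse-pair and
  itinerary cocycles of the tree (`pulseJac`, `itinJac`) are unimodular (`det_pulseJac`, `det_itinJac`), so the rotated cocycle
  is the dual/conormal cocycle (`itinJac_transpose_mul_dual`), acting on rotated vectors as the rotation of the original action
  (`dual_mulVec_rot`); cone avoidance in material form (`dual_cone_growth`, a rewriting of `itinJac_growth_two`).
* BUDGET ALGEBRA: `twoComponent_step` (weighted two-component slot step), `twoSlot_phase`, `twoGeneration_phase` /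
  `twoGeneration_envelope` (two-generation creation recursion ⇒ per-phase factor `max (B + r(P+1)) (P + r)`, the shape of
  `K2PhaseGrowthClassicalH`).
Nothing here is a statement about K2 itself.
-/

set_option linter.dupNamespace false

noncomputable section

namespace Summit.AnomalousDissipation.AnomalousDissipation.Theorems.SawtoothPulseCascade.K2Material

open Set
open Literature.Analysis.FluidPDE.SawtoothCascade

section MaterialDual

open scoped Matrix

/-- The quarter turn `R = [[0,−1],[1,0]]` (tangent ↦ normal of a plane curve). -/
def rot : Matrix (Fin 2) (Fin 2) ℝ := !![0, -1; 1, 0]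

/-- Entry `R₀₀ = 0`. -/
@[simp] theorem rot_00 : rot 0 0 = 0 := by simp [rot]
/-- Entry `R₀₁ = −1`. -/
@[simp] theorem rot_01 : rot 0 1 = -1 := by simp [rot]
/-- Entry `R₁₀ = 1`. -/
@[simp] theorem rot_10 : rot 1 0 = 1 := by simp [rot]
/-- Entry `R₁₁ = 0`. -/
@[simp] theorem rot_11 : rot 1 1 = 0 := by simp [rot]

/-- `R` is orthogonal: `Rᵀ R = 1`. -/
theorem rot_transpose_mul_rot : rotᵀ * rot = 1 := by
  ext i j; fin_cases i <;> fin_cases j <;>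
    simp [Matrix.mul_apply, Fin.sum_univ_two, Matrix.transpose_apply]

/-- `(R v)₀ = −v₁`. -/
theorem rot_mulVec_zero (v : Fin 2 → ℝ) : (rot *ᵥ v) 0 = -v 1 := by
  simp [Matrix.mulVec, dotProduct, Fin.sum_univ_two]

/-- `(R v)₁ = v₀`. -/
theorem rot_mulVec_one (v : Fin 2 → ℝ) : (rot *ᵥ v) 1 = v 0 := by
  simp [Matrix.mulVec, dotProduct, Fin.sum_univ_two]

/-- The conjugate `R M Rᵀ` entrywise: `[[M₁₁, −M₁₀],[−M₀₁, M₀₀]]` (the transposed adjugate). -/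
theorem rot_conj_apply (M : Matrix (Fin 2) (Fin 2) ℝ) :
    (rot * M * rotᵀ) 0 0 = M 1 1 ∧ (rot * M * rotᵀ) 0 1 = -M 1 0 ∧
      (rot * M * rotᵀ) 1 0 = -M 0 1 ∧ (rot * M * rotᵀ) 1 1 = M 0 0 := by
  simp [Matrix.mul_apply, Fin.sum_univ_two, Matrix.transpose_apply]

/-- **Duality in `GL₂`: `Mᵀ · (R M Rᵀ) = det M · 1`.**  For `det M = 1` the conjugate `R M Rᵀ` IS the inverse
transpose `M⁻ᵀ`, i.e. the cocycle acting on conormals (wave-vectors) when `M` acts on tangents (and vice versa). -/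
theorem transpose_mul_rot_conj (M : Matrix (Fin 2) (Fin 2) ℝ) :
    Mᵀ * (rot * M * rotᵀ) = M.det • (1 : Matrix (Fin 2) (Fin 2) ℝ) := by
  ext i j; fin_cases i <;> fin_cases j <;>
    simp [Matrix.mul_apply, Fin.sum_univ_two, Matrix.transpose_apply, Matrix.det_fin_two] <;> ring

/-- The pulse-pair Jacobian is unimodular. -/
theorem det_pulseJac (γ r s : ℝ) : (pulseJac γ r s).det = 1 := by
  simp [pulseJac, Matrix.det_fin_two]; ring

/-- Every itinerary cocycle is unimodular. -/
theorem det_itinJac (γ : ℝ) : ∀ L : List (ℝ × ℝ), (itinJac γ L).det = 1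
  | [] => by simp [itinJac]
  | p :: L => by rw [itinJac, Matrix.det_mul, det_pulseJac, det_itinJac γ L, one_mul]

/-- Hence `(itinJac γ L)ᵀ · (R · itinJac γ L · Rᵀ) = 1`: the rotated cocycle is the dual (inverse-transpose) cocycle. -/
theorem itinJac_transpose_mul_dual (γ : ℝ) (L : List (ℝ × ℝ)) :
    (itinJac γ L)ᵀ * (rot * itinJac γ L * rotᵀ) = 1 := by
  rw [transpose_mul_rot_conj, det_itinJac, one_smul]

/-- The dual cocycle acts on rotated vectors as the rotation of the original action:
`(R M Rᵀ)(R τ) = R (M τ)` — conormal images are the rotated tangent images, with the same length. -/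
theorem dual_mulVec_rot (M : Matrix (Fin 2) (Fin 2) ℝ) (τ : Fin 2 → ℝ) :
    (rot * M * rotᵀ) *ᵥ (rot *ᵥ τ) = rot *ᵥ (M *ᵥ τ) := by
  obtain ⟨h00, h01, h10, h11⟩ := rot_conj_apply M
  ext i; fin_cases i
  · simp [Matrix.mulVec, dotProduct, Fin.sum_univ_two, h00, h01]
    try ring
  · simp [Matrix.mulVec, dotProduct, Fin.sum_univ_two, h10, h11]
    try ring

/-- **Cone avoidance, material form.**  If `τ` lies in the tree's unstable cone `γ|τ₁| ≤ 2|τ₀|` (`γ² ≥ 8`), the image of the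
rotated vector `R τ` under the DUAL cocycle of any sign itinerary has second component of size `≥ (γ²−3)^{|L|} |τ₀|` and stays in
the rotated cone: sheets born transverse to the next shear have conormals (wave-vectors) that expand at the cascade rate and
never visit the Orr-amplifying sector.  (Pure rewriting of `itinJac_growth_two`.) -/
theorem dual_cone_growth {γ : ℝ} (hγ : 0 < γ) (h8 : 8 ≤ γ ^ 2) {L : List (ℝ × ℝ)} (hL : IsSignList L)
    {τ : Fin 2 → ℝ} (hτ : γ * |τ 1| ≤ 2 * |τ 0|) :
    (γ ^ 2 - 3) ^ L.length * |τ 0| ≤ |((rot * itinJac γ L * rotᵀ) *ᵥ (rot *ᵥ τ)) 1| ∧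
      γ * |((rot * itinJac γ L * rotᵀ) *ᵥ (rot *ᵥ τ)) 0| ≤ 2 * |((rot * itinJac γ L * rotᵀ) *ᵥ (rot *ᵥ τ)) 1| := by
  have h := itinJac_growth_two hγ h8 hL hτ
  rw [dual_mulVec_rot, rot_mulVec_one, rot_mulVec_zero, abs_neg]
  exact ⟨h.2, h.1⟩

end MaterialDual

section BudgetAlgebra

/-- **Weighted two-component slot step.**  If the transported ("old") and freshly created ("sheet") energies after a slot obey
`x' ≤ a x + b y`, `y' ≤ c x + d y` with non-negative data, then the weighted budget `x + θ y` (θ > 0) grows by at most `Λ` as soon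
as `a + θ c ≤ Λ` and `b + θ d ≤ Λ θ` (column sums of the weighted transfer matrix).  Chaining two slots and reading `Λ_H Λ_V`
against the cap² is the per-phase material budget of memo §4; `weightedCocycle_energy_bound` then gives K2's shape. -/
theorem twoComponent_step {x y x' y' a b c d θ Λ : ℝ} (hx : 0 ≤ x) (hy : 0 ≤ y) (hθ : 0 < θ)
    (h1 : x' ≤ a * x + b * y) (h2 : y' ≤ c * x + d * y) (hcol1 : a + θ * c ≤ Λ) (hcol2 : b + θ * d ≤ Λ * θ) :
    x' + θ * y' ≤ Λ * (x + θ * y) := by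
  have e1 : (a + θ * c) * x ≤ Λ * x := mul_le_mul_of_nonneg_right hcol1 hx
  have e2 : (b + θ * d) * y ≤ Λ * θ * y := mul_le_mul_of_nonneg_right hcol2 hy
  have e3 : θ * y' ≤ θ * (c * x + d * y) := mul_le_mul_of_nonneg_left h2 hθ.le
  nlinarith [e1, e2, e3, h1]

/-- Two slots compose: factors `Λ₁` then `Λ₂` (same weight) give the phase factor `Λ₁ Λ₂` on the weighted budget. -/
theorem twoSlot_phase {N₀ N₁ N₂ Λ₁ Λ₂ : ℝ} (hΛ₂ : 0 ≤ Λ₂) (h1 : N₁ ≤ Λ₁ * N₀) (h2 : N₂ ≤ Λ₂ * N₁) :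
    N₂ ≤ (Λ₁ * Λ₂) * N₀ := by
  have : Λ₂ * N₁ ≤ Λ₂ * (Λ₁ * N₀) := mul_le_mul_of_nonneg_left h1 hΛ₂
  linarith [this]

/-- **Two-generation recursion ⇒ per-phase factor** (memo `K2MaterialControl.md` §3).  Let `a s ≥ 0` be the amplitude
(√energy) of the fresh sheet generation created in slot `s`, and suppose the creation recursion
`a (s+2) ≤ p (s+1) · a (s+1) + r · a s` (the fresh pair is forced by the last generation with slot constant `p`, and by the
last-but-one with the lag constant `r`), where every slot constant is `≤ P` and CONSECUTIVE slot constants obey the phase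
budget `p (s+1) · p s ≤ B` (one strong slot per phase).  Then the two-generation envelope `max (a (s+1)) (a s)` grows over
one phase (= two slots) by at most `Λ = max (B + r (P + 1)) (P + r)`.  With the measured sharp-model values
(B ≈ 15, P ≈ 14.7, r small) this is ≈ 20 against the cap 59.62; the point of the lemma is WHERE each constant enters. -/
theorem twoGeneration_phase {a p : ℕ → ℝ} {r B P : ℝ} (ha : ∀ s, 0 ≤ a s) (hp : ∀ s, 0 ≤ p s) (hr : 0 ≤ r)
    (hP : ∀ s, p s ≤ P) (hB : ∀ s, p (s + 1) * p s ≤ B)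
    (rec : ∀ s, a (s + 2) ≤ p (s + 1) * a (s + 1) + r * a s) (s : ℕ) :
    max (a (s + 3)) (a (s + 2)) ≤ max (B + r * (P + 1)) (P + r) * max (a (s + 1)) (a s) := by
  set M := max (a (s + 1)) (a s) with hM
  have hM0 : 0 ≤ M := le_trans (ha s) (le_max_right _ _)
  have h1 : a (s + 1) ≤ M := le_max_left _ _
  have h0 : a s ≤ M := le_max_right _ _
  -- slot s+2
  have e2 : a (s + 2) ≤ (p (s + 1) + r) * M := by
    have := rec s
    have u1 : p (s + 1) * a (s + 1) ≤ p (s + 1) * M := mul_le_mul_of_nonneg_left h1 (hp _)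
    have u2 : r * a s ≤ r * M := mul_le_mul_of_nonneg_left h0 hr
    nlinarith
  have e2' : a (s + 2) ≤ (P + r) * M := by
    have : (p (s + 1) + r) * M ≤ (P + r) * M := mul_le_mul_of_nonneg_right (by linarith [hP (s + 1)]) hM0
    linarith
  -- slot s+3
  have e3 : a (s + 3) ≤ (B + r * (P + 1)) * M := by
    have R := rec (s + 1)
    have v1 : p (s + 2) * a (s + 2) ≤ p (s + 2) * (p (s + 1) * a (s + 1) + r * a s) :=
      mul_le_mul_of_nonneg_left (rec s) (hp _)
    have v2 : p (s + 2) * p (s + 1) * a (s + 1) ≤ B * M := by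
      have := mul_le_mul (hB (s + 1)) h1 (ha _) (le_trans (mul_nonneg (hp _) (hp _)) (hB (s + 1)))
      simpa [mul_assoc] using this
    have v3 : p (s + 2) * (r * a s) ≤ P * (r * M) :=
      mul_le_mul (hP (s + 2)) (mul_le_mul_of_nonneg_left h0 hr) (mul_nonneg hr (ha s)) (le_trans (hp (s + 2)) (hP (s + 2)))
    have v4 : r * a (s + 1) ≤ r * M := mul_le_mul_of_nonneg_left h1 hr
    nlinarith
  -- envelope
  have hΛ2 : (P + r) * M ≤ max (B + r * (P + 1)) (P + r) * M := mul_le_mul_of_nonneg_right (le_max_right _ _) hM0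
  have hΛ3 : (B + r * (P + 1)) * M ≤ max (B + r * (P + 1)) (P + r) * M := mul_le_mul_of_nonneg_right (le_max_left _ _) hM0
  exact max_le (le_trans e3 hΛ3) (le_trans e2' hΛ2)

/-- Iterating `twoGeneration_phase`: the two-generation envelope after `j` phases is at most `Λ^j` times the initial one —
the shape of `K2PhaseGrowthClassicalH` (per-phase factor `Λ` in amplitude, to be compared with `C·e^{σ⋆γ}`). -/
theorem twoGeneration_envelope {a p : ℕ → ℝ} {r B P : ℝ} (ha : ∀ s, 0 ≤ a s) (hp : ∀ s, 0 ≤ p s) (hr : 0 ≤ r)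
    (hP : ∀ s, p s ≤ P) (hB : ∀ s, p (s + 1) * p s ≤ B)
    (rec : ∀ s, a (s + 2) ≤ p (s + 1) * a (s + 1) + r * a s) :
    ∀ j : ℕ, max (a (2 * j + 1)) (a (2 * j)) ≤ (max (B + r * (P + 1)) (P + r)) ^ j * max (a 1) (a 0) := by
  intro j
  induction j with
  | zero => simp
  | succ j ih =>
    have step := twoGeneration_phase ha hp hr hP hB rec (2 * j)
    have hΛ : 0 ≤ max (B + r * (P + 1)) (P + r) :=
      le_trans (by nlinarith [hp 0, hP 0, hr] : (0:ℝ) ≤ P + r) (le_max_right _ _)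
    have e1 : 2 * (j + 1) + 1 = 2 * j + 3 := by ring
    have e0 : 2 * (j + 1) = 2 * j + 2 := by ring
    rw [e1, e0, pow_succ]
    calc max (a (2 * j + 3)) (a (2 * j + 2))
        ≤ max (B + r * (P + 1)) (P + r) * max (a (2 * j + 1)) (a (2 * j)) := step
      _ ≤ max (B + r * (P + 1)) (P + r) * ((max (B + r * (P + 1)) (P + r)) ^ j * max (a 1) (a 0)) :=
          mul_le_mul_of_nonneg_left ih hΛ
      _ = (max (B + r * (P + 1)) (P + r)) ^ j * max (B + r * (P + 1)) (P + r) * max (a 1) (a 0) := by ring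

end BudgetAlgebra

end Summit.AnomalousDissipation.AnomalousDissipation.Theorems.SawtoothPulseCascade.K2Material

end
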